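import Summits.ResolutionOfSingularities.ResolutionOfSingularities.Theorems.MarkedTransferCampaignW46WWalkLaws
import HarnessLib

/-!
# [OURS · L1 W4.6 rung (iii-2)] THE W-WALK: COMBINATORIAL TERMINATION — along an infinite model walk the shade is eventually
# constant and, from some stage on, EVERY step is a `T`-step (no sharp-vertical step); the shade-`0` and shade-`≥ p+1` phases
# are finite

Cell `res-hironaka`, LADDER-RESOLUTION rung L (D-0089), slot W4.6 rung (iii); seat res-L1-s46-pv-5 (gen 6), plan
`HOME/L/res-L1-s46-pv-5/W-WALK-PLAN.md` §2. Host route MarkedTransfer, `--supports stmt-ResolutionOfSingularities-16155 --as helper`;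
kind proof (no definition).

THE WALK (input of `eventually_tStep`): sequences `f j ∈ K⟦t,y,z⟧`, boundary exponents `r_t j, r_y j`, orders `d j`, step kinds
`v j ∈ Bool` (`true` = sharp-vertical `V`, realised as `stepT p 0 γ ∘ swapTY`; `false` = `T_{l j}` with cleaning root `γ j`), with at
every stage: `BDiv`, `LowVanish (d j)`, a monomial of degree `d j` (so `d j = ord f j`), the window `p + 1 ≤ d j ≤ 2p − 1`, the boundary
exponents `< p` (isolatedness, via the completion exit door in the assembly file), the transition equations, and (ND) whenever the shade
`σ j = d j − r_t j − r_y j` is `< p` (from o1's regime, assembly file). OUTPUT: `∃ N, ∀ j ≥ N, v j = false`.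
Mechanism (laws of `…WWalkLaws.lean`): `σ` never increases (`shade_succ_le`); an eventually constant shade `s` gives four cases —
`s = 0`: `d` drops at every step (finite); `s ≥ p + 1`: `d` rises at every step (finite); `s = p`: `d` never drops and rises at every
`V`-step (finitely many `V`); `1 ≤ s ≤ p − 1`: (ND) makes every state after the first `y`-ADAPTED, and from a `y`-adapted state the
`V`-step kills the shade, so no `V` occurs.

HONEST FRAMING. OURS; nothing here is a statement of H. Hironaka's manuscript [Hironaka2017] and nothing of it is used. AI-written;
AI review is weaker than expert review. No `sorry`; axioms standard. [folklore] combinatorics; the laws cite [Hauser2010] §§F–G.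
-/

noncomputable section

set_option linter.dupNamespace false -- mandated namespace of this single-conjunct summit

open MvPowerSeries Finset

namespace Summit.ResolutionOfSingularities.ResolutionOfSingularities.Theorems

namespace CampaignW46

namespace WWalk

variable {K : Type*} [Field K]

/-! ## §1 Elementary: an antitone `ℕ`-sequence is eventually constant -/

/-- An antitone sequence of naturals is eventually constant. [folklore] -/
theorem exists_eventually_const_of_antitone (σ : ℕ → ℕ) (h : ∀ j, σ (j + 1) ≤ σ j) :
    ∃ N, ∀ j, N ≤ j → σ j = σ N := by
  classical
  have hanti : ∀ i j, i ≤ j → σ j ≤ σ i := by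
    intro i j hij
    induction hij with
    | refl => exact le_rfl
    | step _ ih => exact (h _).trans ih
  have hex : ∃ m, ∃ j, σ j = m := ⟨σ 0, 0, rfl⟩
  obtain ⟨N, hN⟩ := Nat.find_spec hex
  refine ⟨N, fun j hj => le_antisymm (hanti N j hj) ?_⟩
  rw [hN]
  exact Nat.find_min' hex ⟨j, rfl⟩

/-! ## §2 The walk data and the one-step consequences of the laws -/

section Walk

variable {p : ℕ} (f : ℕ → MvPowerSeries (Option (Fin 2)) K) (rt ry d : ℕ → ℕ)
  (hB : ∀ j, BDiv (rt j) (ry j) (f j)) (hlow : ∀ j, LowVanish (d j) (f j))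
  (hex : ∀ j, ∃ a b c, a + b + c = d j ∧ coeff (mk3 a b c) (f j) ≠ 0)

include hB hex in
/-- `r_t + r_y ≤ d` at every stage. [folklore] -/
theorem rt_add_ry_le (j : ℕ) : rt j + ry j ≤ d j := by
  obtain ⟨a, b, c, habc, hne⟩ := hex j
  have := hB j _ hne
  simp only [mk3_t, mk3_y] at this
  omega

include hlow in
/-- A nonzero coefficient of degree `D` at stage `j` bounds `d j ≤ D`. [folklore] -/
theorem d_le_of_coeff_ne_zero {j a b c : ℕ} (hne : coeff (mk3 a b c) (f j) ≠ 0) : d j ≤ a + b + c := by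
  by_contra hlt
  exact hne (hlow j _ (by rw [degree_mk3]; omega))

variable [DecidableEq K] (v : ℕ → Bool) (l γ : ℕ → K) (hwin : ∀ j, p + 1 ≤ d j ∧ d j ≤ 2 * p - 1)
  (hT : ∀ j, v j = false → f (j + 1) = stepT p (l j) (γ j) (f j) ∧ rt (j + 1) = d j - p ∧
    ry (j + 1) = (if l j = 0 then ry j else 0) ∧ (l j = 0 → 0 < ry j → γ j = 0))
  (hV : ∀ j, v j = true → f (j + 1) = stepT p 0 (γ j) (swapTY (f j)) ∧ rt (j + 1) = d j - p ∧ ry (j + 1) = rt j ∧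
    (0 < rt j → γ j = 0))

include hB hlow hex hwin hT hV in
/-- **The shade never increases along the walk** (LAW 1 of the laws file in its three incarnations). [cite: Hauser2010, §F] -/
theorem shade_succ_le (j : ℕ) : d (j + 1) - rt (j + 1) - ry (j + 1) ≤ d j - rt j - ry j := by
  have hp : p + 1 ≤ d j := (hwin j).1
  have hd2 : d j ≤ 2 * p - 1 := (hwin j).2
  have hsum := rt_add_ry_le f rt ry d hB hex j
  obtain ⟨a, b, c, habc, hne⟩ := hex j
  have hab := hB j _ hne
  simp only [mk3_t, mk3_y] at hab
  cases hvj : v j with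
  | false =>
    obtain ⟨hf, hrt, hry, hγ⟩ := hT j hvj
    by_cases hl : l j = 0
    · rw [hl] at hf
      rw [if_pos hl] at hry
      have hw := coeff_stepT_zero_ne_zero (γ := γ j) hp hd2 (hlow j) habc hne
      rw [← hf] at hw
      have := d_le_of_coeff_ne_zero f d hlow hw
      omega
    · rw [if_neg hl] at hry
      obtain ⟨i, c', hic, hw⟩ := exists_coeff_stepT_ne_zero (l := l j) (γ := γ j) hp hd2 (hlow j) (hB j) (Or.inl hl) habc hne
      rw [← hf] at hw
      have := d_le_of_coeff_ne_zero f d hlow hw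
      omega
  | true =>
    obtain ⟨hf, hrt, hry, hγ⟩ := hV j hvj
    have hne' : coeff (mk3 b a c) (swapTY (f j)) ≠ 0 := by rwa [coeff_swapTY]
    have hw := coeff_stepT_zero_ne_zero (γ := γ j) hp hd2 (lowVanish_swapTY (hlow j)) (by omega : b + a + c = d j) hne'
    rw [← hf] at hw
    have := d_le_of_coeff_ne_zero f d hlow hw
    omega

end Walk

/-! ## §3 The combinatorial termination theorem -/

/-- **COMBINATORIAL TERMINATION OF THE W-WALK.** Along an infinite model walk as described in the module docstring (boundary shape,
orders in the window `[p+1, 2p−1]`, boundary exponents `< p`, transition equations, (ND) whenever the shade is `< p`), from some stage on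
every step is a `T`-step: `∃ N, ∀ j ≥ N, v j = false`. [cite: Hauser2010, §§F–G (the mechanism of the shade; here for arbitrary residuals)] -/
theorem eventually_tStep [DecidableEq K] {p : ℕ} (hp2 : 2 ≤ p) (f : ℕ → MvPowerSeries (Option (Fin 2)) K) (rt ry d : ℕ → ℕ) (v : ℕ → Bool)
    (l γ : ℕ → K)
    (hB : ∀ j, BDiv (rt j) (ry j) (f j)) (hlow : ∀ j, LowVanish (d j) (f j))
    (hex : ∀ j, ∃ a b c, a + b + c = d j ∧ coeff (mk3 a b c) (f j) ≠ 0)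
    (hwin : ∀ j, p + 1 ≤ d j ∧ d j ≤ 2 * p - 1) (hiso : ∀ j, rt j < p ∧ ry j < p)
    (hT : ∀ j, v j = false → f (j + 1) = stepT p (l j) (γ j) (f j) ∧ rt (j + 1) = d j - p ∧
      ry (j + 1) = (if l j = 0 then ry j else 0) ∧ (l j = 0 → 0 < ry j → γ j = 0))
    (hV : ∀ j, v j = true → f (j + 1) = stepT p 0 (γ j) (swapTY (f j)) ∧ rt (j + 1) = d j - p ∧ ry (j + 1) = rt j ∧
      (0 < rt j → γ j = 0))
    (hnd : ∀ j, d j - rt j - ry j < p → NDz (d j) (f j)) :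
    ∃ N, ∀ j, N ≤ j → v j = false := by
  classical
  -- the shade and its eventual value
  set σ : ℕ → ℕ := fun j => d j - rt j - ry j with hσ
  have hmono : ∀ j, σ (j + 1) ≤ σ j := fun j => shade_succ_le f rt ry d hB hlow hex v l γ hwin hT hV j
  obtain ⟨N₀, hN₀⟩ := exists_eventually_const_of_antitone σ hmono
  set s := σ N₀ with hs
  have hsum : ∀ j, rt j + ry j ≤ d j := fun j => rt_add_ry_le f rt ry d hB hex j
  have hdle : ∀ {j a b c}, coeff (mk3 a b c) (f j) ≠ 0 → d j ≤ a + b + c :=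
    fun h => d_le_of_coeff_ne_zero f d hlow h
  -- the transition of `d` under a stall: `d (j+1) = (d j - p) + r_y (j+1) + s`
  have hd_succ : ∀ j, N₀ ≤ j → d (j + 1) = d j - p + ry (j + 1) + s := by
    intro j hj
    have h1 : σ (j + 1) = s := hN₀ (j + 1) (by omega)
    have hrt : rt (j + 1) = d j - p := by
      cases hvj : v j with
      | false => exact (hT j hvj).2.1
      | true => exact (hV j hvj).2.1
    have := hsum (j + 1)
    simp only [hσ] at h1
    omega
  -- CASE ANALYSIS on `s`
  by_cases hs0 : s = 0
  · -- shade 0: `d` drops at every step — impossible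
    exfalso
    have hdrop : ∀ j, N₀ ≤ j → d (j + 1) + 1 ≤ d j := by
      intro j hj
      have hjσ : σ j = 0 := (hN₀ j hj).trans hs0
      have hd : d j = rt j + ry j := by simp only [hσ] at hjσ; have := hsum j; omega
      have hp1 : p + 1 ≤ d j := (hwin j).1
      have hd2 : d j ≤ 2 * p - 1 := (hwin j).2
      -- the corner `t^{r_t} y^{r_y}` is the only degree-`d` monomial, so both adaptedness flags hold
      have hcorner : coeff (mk3 (rt j) (ry j) 0) (f j) ≠ 0 := by
        obtain ⟨a, b, c, habc, hne⟩ := hex j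
        have hab := hB j _ hne
        simp only [mk3_t, mk3_y] at hab
        have ha : a = rt j := by omega
        have hb : b = ry j := by omega
        have hc : c = 0 := by omega
        subst ha hb hc
        exact hne
      cases hvj : v j with
      | false =>
        obtain ⟨hf, hrt, hry, hγ⟩ := hT j hvj
        by_cases hl : l j = 0
        · rw [hl] at hf
          have hT' : TAdapted (ry j) (d j) (f j) := by rw [TAdapted, show d j - ry j = rt j by omega]; exact hcorner
          have hw := coeff_stepT_zero_corner_ne_zero (γ := γ j) hp1 hd2 (hlow j) (by omega) hT'
          rw [← hf] at hw
          have := hdle hw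
          have := (hiso j).2
          omega
        · obtain ⟨i, c', hic, hw⟩ := exists_coeff_stepT_ne_zero (l := l j) (γ := γ j) hp1 hd2 (hlow j) (hB j) (Or.inl hl)
            (by omega : rt j + ry j + 0 = d j) hcorner
          rw [← hf] at hw
          have := hdle hw
          have := (hwin (j + 1)).1
          omega
      | true =>
        obtain ⟨hf, hrt, hry, hγ⟩ := hV j hvj
        have hT' : TAdapted (rt j) (d j) (swapTY (f j)) := by
          rw [tAdapted_swapTY_iff, YAdapted, show d j - rt j = ry j by omega]; exact hcorner
        have hw := coeff_stepT_zero_corner_ne_zero (γ := γ j) hp1 hd2 (lowVanish_swapTY (hlow j)) (by omega) hT'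
        rw [← hf] at hw
        have := hdle hw
        have := (hiso j).1
        omega
    have hind : ∀ k, d (N₀ + k) + k ≤ d N₀ := by
      intro k
      induction k with
      | zero => simp
      | succ k ih => have := hdrop (N₀ + k) (by omega); rw [show N₀ + (k + 1) = N₀ + k + 1 by omega]; omega
    have := hind (d N₀ + 1)
    omega
  by_cases hsp : p + 1 ≤ s
  · -- shade ≥ p + 1: `d` rises at every step — impossible
    exfalso
    have hrise : ∀ j, N₀ ≤ j → d j + 1 ≤ d (j + 1) := by
      intro j hj
      have := hd_succ j hj
      have := (hwin j).1
      omega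
    have hind : ∀ k, d N₀ + k ≤ d (N₀ + k) := by
      intro k
      induction k with
      | zero => simp
      | succ k ih => have := hrise (N₀ + k) (by omega); rw [show N₀ + (k + 1) = N₀ + k + 1 by omega]; omega
    have := hind (2 * p)
    have := (hwin (N₀ + 2 * p)).2
    have := (hwin N₀).1
    omega
  by_cases hsp' : s = p
  · -- shade = p: `d` never drops and rises at every `V`-step (j ≥ 1): finitely many `V`
    have hnd' : ∀ j, N₀ ≤ j → d j ≤ d (j + 1) := by
      intro j hj; have := hd_succ j hj; omega
    have hmono' : ∀ i k, N₀ ≤ i → d i ≤ d (i + k) := by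
      intro i k hi
      induction k with
      | zero => simp
      | succ k ih =>
        have := hnd' (i + k) (by omega)
        rw [show i + (k + 1) = i + k + 1 by omega]
        exact ih.trans this
    have hriseV : ∀ j, N₀ ≤ j → 1 ≤ j → v j = true → d j + 1 ≤ d (j + 1) := by
      intro j hj hj1 hvj
      obtain ⟨hf, hrt, hry, hγ⟩ := hV j hvj
      have := hd_succ j hj
      -- `r_t j ≥ 1` for `j ≥ 1`
      have hrt1 : 1 ≤ rt j := by
        obtain ⟨j', rfl⟩ : ∃ j', j = j' + 1 := ⟨j - 1, by omega⟩
        have : rt (j' + 1) = d j' - p := by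
          cases hvj' : v j' with
          | false => exact (hT j' hvj').2.1
          | true => exact (hV j' hvj').2.1
        have := (hwin j').1
        omega
      omega
    by_contra hall
    push Not at hall
    -- infinitely many `V`: `d` grows without bound
    have hgrow : ∀ k, ∃ j, N₀ + 1 ≤ j ∧ d (N₀ + 1) + k ≤ d j := by
      intro k
      induction k with
      | zero => exact ⟨N₀ + 1, le_rfl, by simp⟩
      | succ k ih =>
        obtain ⟨j, hj, hdj⟩ := ih
        obtain ⟨j', hj', hvj'⟩ := hall j
        have hvt : v j' = true := by simpa using hvj'
        refine ⟨j' + 1, by omega, ?_⟩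
        have h1 := hmono' j (j' - j) (by omega)
        rw [show j + (j' - j) = j' by omega] at h1
        have h2 := hriseV j' (by omega) (by omega) hvt
        omega
    obtain ⟨j, hj, hdj⟩ := hgrow (2 * p)
    have := (hwin j).2
    have := (hwin (N₀ + 1)).1
    omega
  · -- 1 ≤ s ≤ p − 1: every state after `N₀` is `y`-adapted, and then no `V`-step
    have hs1 : 1 ≤ s := by omega
    have hsp1 : s < p := by omega
    refine ⟨N₀ + 1, fun j hj => ?_⟩
    -- `y`-adaptedness of the state `j` from the stall `j - 1 → j`
    obtain ⟨i, rfl⟩ : ∃ i, j = i + 1 := ⟨j - 1, by omega⟩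
    have hi : N₀ ≤ i := by omega
    have hσi : d i - rt i - ry i = s := hN₀ i hi
    have hσi1 : d (i + 1) - rt (i + 1) - ry (i + 1) = s := hN₀ (i + 1) (by omega)
    have hp1 : p + 1 ≤ d i := (hwin i).1
    have hd2 : d i ≤ 2 * p - 1 := (hwin i).2
    have hndi : NDz (d i) (f i) := hnd i (by omega)
    have hsumi := hsum i
    have hsumi1 := hsum (i + 1)
    have hadapt : YAdapted (rt (i + 1)) (d (i + 1)) (f (i + 1)) := by
      cases hvi : v i with
      | false =>
        obtain ⟨hf, hrt, hry, hγ⟩ := hT i hvi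
        by_cases hl : l i = 0
        · rw [hl] at hf
          rw [if_pos hl] at hry
          have hd1 : d (i + 1) = d i - p + (d i - rt i) := by have := hd_succ i hi; omega
          have hstall : LowVanish (d i - p + (d i - rt i)) (stepT p 0 (γ i) (f i)) := by rw [← hd1, ← hf]; exact hlow (i + 1)
          have hpar := yAdapted_of_ndz_of_stall_zero hp1 hd2 (hlow i) (hB i) hstall hndi
          have := (yAdapted_stepT_zero_iff (γ := γ i) hp1 hd2 (hlow i) hsumi).mpr hpar
          rwa [← hf, ← hd1, ← hrt] at this
        · rw [if_neg hl] at hry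
          have hd1 : d (i + 1) = d i - p + (d i - rt i - ry i) := by have := hd_succ i hi; omega
          have hstall : LowVanish (d i - p + (d i - rt i - ry i)) (stepT p (l i) (γ i) (f i)) := by
            rw [← hd1, ← hf]; exact hlow (i + 1)
          have hpar := yAdapted_of_ndz_of_stall hp1 hd2 (hlow i) (hB i) (Or.inl hl) hstall hndi
          have := (yAdapted_stepT_iff_of_stall hp1 hd2 (hlow i) (hB i) hsumi hl hstall).mpr hpar
          rwa [← hf, ← hd1, ← hrt] at this
      | true =>
        obtain ⟨hf, hrt, hry, hγ⟩ := hV i hvi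
        have hd1 : d (i + 1) = d i - p + (d i - ry i) := by have := hd_succ i hi; omega
        have hstall : LowVanish (d i - p + (d i - ry i)) (stepT p 0 (γ i) (swapTY (f i))) := by
          rw [← hd1, ← hf]; exact hlow (i + 1)
        have hpar := yAdapted_of_ndz_of_stall_zero hp1 hd2 (lowVanish_swapTY (hlow i)) (bdiv_swapTY (hB i)) hstall
          (ndz_swapTY_iff.mpr hndi)
        have := (yAdapted_stepT_zero_iff (γ := γ i) hp1 hd2 (lowVanish_swapTY (hlow i)) (by omega : ry i + rt i ≤ d i)).mpr hpar
        rwa [← hf, ← hd1, ← hrt] at this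
    -- a `V`-step from a `y`-adapted state kills the shade
    by_contra hv1
    have hvt : v (i + 1) = true := by simpa using hv1
    obtain ⟨hf, hrt, hry, hγ⟩ := hV (i + 1) hvt
    have hT' : TAdapted (rt (i + 1)) (d (i + 1)) (swapTY (f (i + 1))) := tAdapted_swapTY_iff.mpr hadapt
    have hw := coeff_stepT_zero_corner_ne_zero (γ := γ (i + 1)) (hwin (i + 1)).1 (hwin (i + 1)).2
      (lowVanish_swapTY (hlow (i + 1))) (by omega) hT'
    rw [← hf] at hw
    have h1 := hdle hw
    have h2 : d (i + 1 + 1) - rt (i + 1 + 1) - ry (i + 1 + 1) = s := hN₀ (i + 1 + 1) (by omega)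
    have h3 := hsum (i + 1 + 1)
    omega

end WWalk

end CampaignW46

end Summit.ResolutionOfSingularities.ResolutionOfSingularities.Theorems

end
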